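import Summits.HodgeConjecture.HodgeConjecture.Theses.GenericDivisibility
import Literature.AlgebraicGeometry.HodgeTheory.RationalLatticeIntegral
import Literature.AlgebraicGeometry.HodgeTheory.IntegralClassesCountable

/-!
# Route GenericDivisibility — `MiddleConiveauOne` (item stmt-HodgeConjecture-18468)

The support item `MiddleConiveauOne` of route `GenericDivisibility` is the seam between the two
cruxes and the dimension induction of the deciding theorem `closes`:
`HodgeClassesGenericallyDivisible → GenericDivisibilityBounded →` every RATIONAL middle-degree class
of Hodge type `(p, p)` on a smooth projective complex `2p`-fold (`p ≥ 1`) has coniveau `≥ 1`, i.e.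
lies in `supportedClasses X (2 * p) 1`.

Proof (as prescribed by the item's docstring): a rational class `c` has an integral multiple
`N • c`, `N ≥ 1` (`IsRationalClass.exists_nsmul_isIntegralClass`, universal coefficients on the
compact manifold `X(ℂ)`), which is the complexification of an integral class `z ∈ H²ᵖ(X(ℂ); ℤ)`
(`isIntegralClass_iff_mem_range_ringChange`); `N • c` is still of type `(p, p)`
(`H^{p,p}` of a Hodge model is a complex subspace), so C1 makes `z` divisible by every `m ≥ 1` on non-empty Zariski opens and
C2 puts its complexification `N • c` in the `ℂ`-submodule `N¹ H²ᵖ(X(ℂ); ℂ)`; dividing by `N` there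
gives `c ∈ N¹`.  Self-contained: it imports only this route's thesis file and two proved
Literature modules (no named fact is taken as a hypothesis).
-/

-- `Summit.HodgeConjecture.HodgeConjecture.Theorems` is the mandated namespace (single-problem summit:
-- Problem = Summit), which `linter.dupNamespace` flags on every declaration; the lakefile turns the
-- linter off tree-wide (weak option), restated here so stand-alone elaboration is warning-free too.
set_option linter.dupNamespace false

noncomputable section

namespace Summit.HodgeConjecture.HodgeConjecture.Theorems

open Literature.AlgebraicGeometry.Motives Literature.AlgebraicGeometry.HodgeTheory
  Literature.AlgebraicTopology.SingularHomology

/-- **Item stmt-HodgeConjecture-18468 (`MiddleConiveauOne`), route `GenericDivisibility`**: granted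
C1 (`HodgeClassesGenericallyDivisible`: integral middle-degree classes with complexification of type
`(p, p)` are divisible by every `m ≥ 1` on non-empty Zariski opens) and C2
(`GenericDivisibilityBounded`: integral middle-degree classes so divisible have complexification of
coniveau `≥ 1`), every rational class `c ∈ H²ᵖ(X(ℂ); ℂ)` of Hodge type `(p, p)` on a smooth
projective `2p`-fold `X` (`p ≥ 1`) lies in `supportedClasses X (2 * p) 1`.  Take `N ≥ 1` with
`N • c` integral (Voisin I §7.1.1 / Hatcher Thm. 3.2: `Hᵏ(X, ℤ) ⊗ ℚ = Hᵏ(X, ℚ)`), write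
`N • c = z ⊗ ℂ` for an integral class `z` (Hatcher §3.1 p. 198), apply C1 then C2 to `z`
(`N • c` is of type `(p, p)` since `H^{p,p}` is a complex subspace), and divide by `N` in the
`ℂ`-submodule `N¹`.  The type is literally the route decl
`Summit.HodgeConjecture.HodgeConjecture.Theses.GenericDivisibility.MiddleConiveauOne`.
[cite: VoisinHodgeI2002, §7.1.1] [cite: HatcherAT2002, §3.1 Thm. 3.2 and p. 198] -/
theorem genericDivisibility_middleConiveauOne_proof :
    Summit.HodgeConjecture.HodgeConjecture.Theses.GenericDivisibility.MiddleConiveauOne := by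
  unfold Summit.HodgeConjecture.HodgeConjecture.Theses.GenericDivisibility.MiddleConiveauOne
  intro h1 h2 p X hp hX c hc hpp
  -- an integral multiple `N • c`, `N ≥ 1`, lifted to an integral class `z`
  obtain ⟨N, hN, hNc⟩ := hc.exists_nsmul_isIntegralClass hX
  obtain ⟨z, hz⟩ := (isIntegralClass_iff_mem_range_ringChange _).1 hNc
  -- `z ⊗ ℂ = N • c` is of Hodge type `(p, p)`
  have hzpp : IsOfHodgeType (2 * p) X (2 * p) p p
      (singularCohomology.ringChange (Int.castRingHom ℂ) (ComplexPoints X) (2 * p) z) := by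
    rw [hz]
    obtain ⟨A, hA⟩ := hpp
    exact ⟨A, by rw [map_smul]; exact Submodule.smul_mem _ _ hA⟩
  -- C1: `z` is divisible by every `m ≥ 1` on non-empty Zariski opens; C2: `z ⊗ ℂ ∈ N¹`
  have hmem : singularCohomology.ringChange (Int.castRingHom ℂ) (ComplexPoints X) (2 * p) z ∈
      supportedClasses X (2 * p) 1 :=
    h2 hp hX z (h1 hp hX z hzpp)
  rw [hz] at hmem
  -- divide by `N` in the `ℂ`-submodule `N¹`
  have hN' : (N : ℂ) ≠ 0 := Nat.cast_ne_zero.2 hN.ne'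
  have hc' : (N : ℂ)⁻¹ • ((N : ℂ) • c) ∈ supportedClasses X (2 * p) 1 :=
    Submodule.smul_mem _ _ hmem
  rwa [smul_smul, inv_mul_cancel₀ hN', one_smul] at hc'

end Summit.HodgeConjecture.HodgeConjecture.Theorems

end
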